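import Literature.AlgebraicGeometry.ModuliOfAbelianVarieties.SiegelFineModuliSchemeLevelKernelAction
import Literature.AlgebraicGeometry.Motives.FiniteQuotientProjective
import Literature.AlgebraicGeometry.HodgeTheory.QuasiProjectiveSeparatedOfField
import HarnessLib

/-!
# The quotient of a fine moduli carrier by the level-`N₀` kernel, as a `ℚ`-scheme
# ([MumfordFogartyKirwan1994] Ch. 7 §3 pp. 139–140: `𝒜_{g,d,n} = 𝒜_{g,d,nk}/Γ`; [MumfordAV1970] §7 Thm. p. 66)

Topic `AlgebraicGeometry/ModuliOfAbelianVarieties`; namespace `Literature.AlgebraicGeometry.ModuliOfAbelianVarieties.SiegelFineModuliScheme`.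
THEOREMS ONLY (no definition, no named fact, no instance, no notation, no `sorry`; the quotient is produced inside an `∃`).
Cell `hodgecm-mathlib` (D-0151), F-DAG F-10 (b) TAIL, brick **(Q) THE QUOTIENT** (B-plan1 (g16) 07:02:28Z / 07:14:45Z; author
B-p02 (g13); signature sheet `B-provers/B-p06/g11/F10b-CENSUS-SKELETON.B-p06g11.md` Addendum 4).  Count-neutral capital;
HC_CM is proved only modulo the 7 printed citations until rung 0 closes — nothing here is about HC.

[MumfordFogartyKirwan1994] Ch. 7 §3 (pp. 139–140): «`Γ_n` … acts on `𝒜_{g,d,n}`, hence if a fine moduli scheme `A_{g,d,n}`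
exists, it acts on `A_{g,d,n}` … `𝒜_{g,d,n} ≅ 𝒜_{g,d,nk}/Γ_n^{(k)}`»; the quotient of a quasi-projective scheme by a finite
group exists ([MumfordAV1970] §7 Thm. p. 66 and Remark: `(Y, π)` is a categorical quotient, `π` finite surjective).  Here:
for a fine moduli carrier `𝓜` of level `N` (★ `SiegelFineModuliScheme g N δ`) which is QUASI-PROJECTIVE over `ℚ` (a
binder — the carrier records no projectivity; MFK Thm. 7.9 supplies it) and a level `N₀`, the finite group
`Δ = red(K_δ(N₀)) ≤ GL_{2g}(ℤ/N)` acts on `M` through the twist operators (★ (Q-lite)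
`exists_levelKernel_finite_action`), and Mumford's quotient ★ `Motives.finiteQuotient` of this action is a `ℚ`-scheme
`Q = M/Δ` with a FINITE SURJECTIVE `ℚ`-morphism `p : M → Q` which (i) is killed by every twist operator `T_Γ̄`,
`Γ̄ = red γ`, `γ ∈ K_δ(N₀)` — the hypothesis `hp` of the (b2) descent files ★ `SiegelFineModuliSchemeClassifyCoequalKernelPair`
/ `…ClassifyLevelQuotientExists` — and (ii) is universal among such `ℚ`-morphisms to separated `ℚ`-schemes.

* **`exists_levelGroupQuotient_action`** — THE QUOTIENT WITH ITS ACTION DATUM: `∃ red Δ act Q p ρ` — the reduction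
  `red : K_δ(1) → GL_{2g}(ℤ/N)`, the finite group `Δ`, the action `act : Δ →* Aut M` with its four description clauses
  (verbatim ★ (Q-lite)), the quotient `p : M → Q` over `ℚ`, the same action `ρ : ActionOver p.left Δ` viewed over `p`
  (`(ρ.aut x).hom = (act x).hom.left`), and: `ρ.IsGeometricQuotient p.left` (Mumford's (1)–(2), what the descent ★
  `exists_triple_desc_of_free_base_quotient` (10a) consumes), `IsFinite p.left`, `IsSeparated Q.hom`,
  `LocallyOfFiniteType Q.hom`, `IsQuasiProjectiveOver Q` (★ `isQuasiProjectiveOver_finiteQuotient`, [MumfordAV1970] §7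
  Remark p. 69 — the (F) clause the level-descended carrier must keep), the twist-invariance `hp` (in the
  `K_δ(N₀)`-residue currency of ★ p764132 §4), and the universal property for twist-invariant `ℚ`-morphisms to separated
  targets.
* **`exists_levelGroupQuotient`** — the slim form `∃ Q p`: `IsFinite`, `Surjective`, `IsSeparated`, `LocallyOfFiniteType`,
  `IsLocallyNoetherian Q.left`, `hp`, universal property.

NOT here (separate bricks): flatness/étaleness of `p` (= FREENESS of the `Δ`-action, Serre's lemma via ★
`PolarizedTripleRigidity`), the descended universal triple on `Q` ((10a) ★ `exists_triple_desc_of_free_base_quotient`), the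
relation (b2′) and the packaging (pack).

## References
* [MumfordFogartyKirwan1994] D. Mumford, J. Fogarty, F. Kirwan, *Geometric Invariant Theory*, 3rd ed. (1994), Ch. 7 §3
  (pp. 139–140), Lemma 7.11 (p. 140), Theorem 7.9 (p. 139).
* [MumfordAV1970] D. Mumford, *Abelian Varieties* (1970), §7 Thm. p. 66 (and Remark p. 69).
* [Deligne1971TravauxShimura] P. Deligne, *Travaux de Shimura* (1971), 4.16–4.17 p. 150.
-/

noncomputable section

open CategoryTheory CategoryTheory.Limits AlgebraicGeometry

namespace Literature.AlgebraicGeometry.ModuliOfAbelianVarieties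

namespace SiegelFineModuliScheme

open Literature.AlgebraicGeometry.Motives
open Literature.AlgebraicGeometry.AbelianSchemes (PolarizedAbelianSchemeWithLevel)
open Literature.AlgebraicGeometry.AbelianSchemes.AbelianSchemeOver Literature.AlgebraicGeometry.RelativeSpec
  Literature.AlgebraicGeometry.HodgeTheory Literature.NumberTheory.Adeles NumberField IsDedekindDomain
open scoped Matrix

variable {g N : ℕ} {δ : Fin g → ℕ} (𝓜 : SiegelFineModuliScheme g N δ) [IsCommMonObj 𝓜.univ.A.X] [NeZero N]

/-- **THE QUOTIENT OF A FINE MODULI CARRIER BY THE LEVEL-`N₀` KERNEL, WITH ITS ACTION DATUM**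
([MumfordFogartyKirwan1994] Ch. 7 §3 pp. 139–140; [MumfordAV1970] §7 Thm. p. 66 (1), (2)).  For `𝓜` a fine moduli carrier
of level `N`, quasi-projective over `ℚ`, and a level `N₀`: there are the reduction `red : K_δ(1) → GL_{2g}(ℤ/N)` (entries =
residues of the integral finite-adelic entries), a finite subgroup `Δ ∋ red(K_δ(N₀))`, exhausted by `red(K_δ(N₀))`, acting
on `M` by `act : Δ →* Aut M` with `(act (red γ))⁻¹ = T_{red γ}` the twist operator (these four clauses are ★ (Q-lite)
`exists_levelKernel_finite_action`, passed through), a `ℚ`-scheme `Q` (separated, locally of finite type, QUASI-PROJECTIVE over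
`ℚ` — [MumfordAV1970] §7 Remark p. 69, ★ `isQuasiProjectiveOver_finiteQuotient`) with a FINITE
`ℚ`-morphism `p : M → Q`, and the same action viewed over `p`, `ρ : ActionOver p.left Δ`, such that: `p` is a GEOMETRIC
QUOTIENT of `M` by `ρ` in Mumford's sense (surjective, open, fibres = orbits, `𝒪_Q = (p_*𝒪_M)^Δ` — the input of the descent
★ `exists_triple_desc_of_free_base_quotient`), `T_Γ̄ ≫ p = p` for every `γ ∈ K_δ(N₀)` with residue `Γ̄` (the hypothesis
`hp` of ★ `existsUnique_desc_classifyingMap_left_comp`), and every `ℚ`-morphism `h : M → Z` to a separated `Z` with the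
same invariance factors uniquely through `p`.  Construction: Mumford's quotient ★ `Motives.finiteQuotient` of the action over
`Spec ℚ` (the `Δ`-stable affine opens cover `M` by quasi-projectivity, ★
`ActionOver.forall_exists_stableAffineOpen_of_isQuasiProjectiveOver`); geometric quotient ★ `isGeometricQuotient_gluedMk`
(moved over `p` by ★ `isGeometricQuotient_overMap_iff`); invariance ★ `finiteQuotient.overIso_hom_mk`; universality ★
`finiteQuotient.desc` / `mk_desc` / `desc_unique`.
[cite: MumfordFogartyKirwan1994, Ch. 7 §3 (pp. 139–140) and Lemma 7.11 (p. 140)] [cite: MumfordAV1970, §7 Thm. p. 66] -/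
theorem exists_levelGroupQuotient_action (hδ : IsPolarizationType δ) (hg : 0 < g) (N₀ : ℕ)
    (hqp : IsQuasiProjectiveOver 𝓜.M) :
    ∃ (red : principalLevelSubgroup δ 1 →* GL (Fin g ⊕ Fin g) (ZMod N))
      (Δ : Subgroup (GL (Fin g ⊕ Fin g) (ZMod N))) (act : Δ →* Aut 𝓜.M)
      (Q : SchemeOver ℚ) (p : 𝓜.M ⟶ Q) (ρ : ActionOver p.left Δ),
      (∀ (k : principalLevelSubgroup δ 1) (i j : Fin g ⊕ Fin g)
        (h : (((k : gspFinAdelic δ) : GL (Fin g ⊕ Fin g) finAdeleQ) :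
            Matrix (Fin g ⊕ Fin g) (Fin g ⊕ Fin g) finAdeleQ) i j ∈ FiniteAdeleRing.integralAdeles (𝓞 ℚ) ℚ),
        (red k : Matrix (Fin g ⊕ Fin g) (Fin g ⊕ Fin g) (ZMod N)) i j = integralAdeleResidue N ⟨_, h⟩) ∧
      (∀ k : principalLevelSubgroup δ 1, (k : gspFinAdelic δ) ∈ principalLevelSubgroup δ N₀ → red k ∈ Δ) ∧
      (∀ x : Δ, ∃ k : principalLevelSubgroup δ 1, (k : gspFinAdelic δ) ∈ principalLevelSubgroup δ N₀ ∧ red k = x) ∧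
      (∀ (k : principalLevelSubgroup δ 1) (hk : red k ∈ Δ),
        ∃ hs : (𝓜.univ.level.twist (red k)).IsSymplecticLiftable 𝓜.univ.pol δ,
          (act ⟨red k, hk⟩).inv = (haveI := 𝓜.isLocallyNoetherian
            𝓜.classifyingMap 𝓜.M ({ 𝓜.univ with level := 𝓜.univ.level.twist (red k), symplectic := hs } :
              PolarizedAbelianSchemeWithLevel g N δ 𝓜.M.left))) ∧
      (∀ x : Δ, (ρ.aut x).hom = (act x).hom.left) ∧ ρ.IsGeometricQuotient p.left ∧
      IsFinite p.left ∧ IsSeparated Q.hom ∧ LocallyOfFiniteType Q.hom ∧ IsQuasiProjectiveOver Q ∧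
      (∀ (r : gspFinAdelic δ) (_ : r ∈ principalLevelSubgroup δ N₀) (GN : GL (Fin g ⊕ Fin g) (ZMod N))
        (_ : ∀ (i j : Fin g ⊕ Fin g)
          (h : ((r : GL (Fin g ⊕ Fin g) finAdeleQ) : Matrix (Fin g ⊕ Fin g) (Fin g ⊕ Fin g) finAdeleQ) i j ∈
            FiniteAdeleRing.integralAdeles (𝓞 ℚ) ℚ),
          (GN : Matrix (Fin g ⊕ Fin g) (Fin g ⊕ Fin g) (ZMod N)) i j = integralAdeleResidue N ⟨_, h⟩)
        (hs : (𝓜.univ.level.twist GN).IsSymplecticLiftable 𝓜.univ.pol δ),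
        (haveI := 𝓜.isLocallyNoetherian
         (𝓜.classifyingMap 𝓜.M ({ 𝓜.univ with level := 𝓜.univ.level.twist GN, symplectic := hs } :
           PolarizedAbelianSchemeWithLevel g N δ 𝓜.M.left)).left) ≫ p.left = p.left) ∧
      ∀ (Z : SchemeOver ℚ) [Z.left.IsSeparated] (h : 𝓜.M ⟶ Z),
        (∀ (r : gspFinAdelic δ) (_ : r ∈ principalLevelSubgroup δ N₀) (GN : GL (Fin g ⊕ Fin g) (ZMod N))
          (_ : ∀ (i j : Fin g ⊕ Fin g)
            (h : ((r : GL (Fin g ⊕ Fin g) finAdeleQ) : Matrix (Fin g ⊕ Fin g) (Fin g ⊕ Fin g) finAdeleQ) i j ∈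
              FiniteAdeleRing.integralAdeles (𝓞 ℚ) ℚ),
            (GN : Matrix (Fin g ⊕ Fin g) (Fin g ⊕ Fin g) (ZMod N)) i j = integralAdeleResidue N ⟨_, h⟩)
          (hs : (𝓜.univ.level.twist GN).IsSymplecticLiftable 𝓜.univ.pol δ),
          (haveI := 𝓜.isLocallyNoetherian
           𝓜.classifyingMap 𝓜.M ({ 𝓜.univ with level := 𝓜.univ.level.twist GN, symplectic := hs } :
             PolarizedAbelianSchemeWithLevel g N δ 𝓜.M.left)) ≫ h = h) →
        ∃! hQ : Q ⟶ Z, p ≫ hQ = h := by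
  classical
  haveI := 𝓜.isLocallyNoetherian
  haveI : IsSeparated 𝓜.M.hom := hqp.hom_isSeparated
  haveI : LocallyOfFiniteType 𝓜.M.hom := hqp.hom_locallyOfFiniteType
  -- the finite action of `Δ = red(K_δ(N₀))` on `M` through the twist operators, over `Spec ℚ`
  obtain ⟨red, Δ, act, hred, hΔ, hΔsurj, hact, hΔp⟩ := 𝓜.exists_levelKernel_finite_action hδ hg N₀
  let ρ₀ : ActionOver 𝓜.M.hom Δ := ⟨((Over.forget _).mapAut 𝓜.M).comp act, fun x => Over.w (act x).hom⟩
  have hcov := ρ₀.forall_exists_stableAffineOpen_of_isQuasiProjectiveOver hqp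
  -- Mumford's quotient and the invariance of `p` under `Δ`
  have hsep : IsSeparated (finiteQuotient ρ₀).hom := isSeparated_finiteQuotient_hom ρ₀ hcov
  have hlft : LocallyOfFiniteType (finiteQuotient ρ₀).hom := locallyOfFiniteType_finiteQuotient_hom ρ₀
  have hinv : ∀ x : Δ, (ρ₀.aut x).hom ≫ (finiteQuotient.mk ρ₀ hcov).left = (finiteQuotient.mk ρ₀ hcov).left :=
    fun x => by
    have h := congrArg CommaMorphism.left (finiteQuotient.overIso_hom_mk ρ₀ hcov x)
    simp only [Over.comp_left, ActionOver.overIso_hom_left] at h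
    exact h
  -- the same action viewed over `p`; it is a geometric quotient (Mumford (1), (2))
  let ρ : ActionOver (finiteQuotient.mk ρ₀ hcov).left Δ := ⟨ρ₀.aut, hinv⟩
  have hq : ρ.IsGeometricQuotient (finiteQuotient.mk ρ₀ hcov).left :=
    (ρ₀.isGeometricQuotient_overMap_iff _ hinv _).mpr (ρ₀.isGeometricQuotient_gluedMk hcov)
  refine ⟨red, Δ, act, finiteQuotient ρ₀, finiteQuotient.mk ρ₀ hcov, ρ, hred, hΔ, hΔsurj, hact, fun x => rfl, hq,
    finiteQuotient.isFinite_mk_left ρ₀ hcov, hsep, hlft, isQuasiProjectiveOver_finiteQuotient ρ₀ hqp, ?_, ?_⟩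
  · -- (i) invariance under the twist operators: (Q-lite)'s last clause fed with the `Δ`-invariance of `p`
    exact hΔp _ hinv
  · -- (ii) the universal property for twist-invariant `ℚ`-morphisms to separated targets
    intro Z _ h hh
    -- `h` is `Δ`-invariant: every `x ∈ Δ` is `red k` with `k ∈ K_δ(N₀)`, and `(act x)⁻¹ = T_{red k}`
    have hhinv : ∀ x : Δ, (ρ₀.overIso x).hom ≫ h = h := by
      intro x
      obtain ⟨k, hk, hkx⟩ := hΔsurj x
      have hxΔ : red k ∈ Δ := hkx ▸ x.2
      obtain ⟨hs, hTinv⟩ := hact k hxΔ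
      have hx : x = ⟨red k, hxΔ⟩ := Subtype.ext hkx.symm
      -- `T_{red k} ≫ h = h`
      have hT := hh (k : gspFinAdelic δ) hk (red k) (hred k) hs
      rw [← hTinv] at hT
      -- `(act x).hom ≫ h = h` from `(act x).inv ≫ h = h`
      have hhom : (act ⟨red k, hxΔ⟩).hom ≫ h = h := by
        have h2 := congrArg (fun t => (act ⟨red k, hxΔ⟩).hom ≫ t) hT
        simp only [Iso.hom_inv_id_assoc] at h2
        exact h2.symm
      subst hx
      ext : 1
      have hl := congrArg CommaMorphism.left hhom
      simp only [Over.comp_left, ActionOver.overIso_hom_left] at hl ⊢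
      exact hl
    refine ⟨finiteQuotient.desc ρ₀ hcov h hhinv, finiteQuotient.mk_desc ρ₀ hcov h hhinv, fun h' hh' => ?_⟩
    exact finiteQuotient.desc_unique ρ₀ hcov h hhinv h' hh'

/-- **THE QUOTIENT OF A FINE MODULI CARRIER BY THE LEVEL-`N₀` KERNEL** ([MumfordFogartyKirwan1994] Ch. 7 §3 pp. 139–140;
[MumfordAV1970] §7 Thm. p. 66).  For `𝓜` a fine moduli carrier of level `N`, quasi-projective over `ℚ`, and a level `N₀`:
there are a `ℚ`-scheme `Q` (separated, locally of finite type, locally Noetherian) and a FINITE SURJECTIVE `ℚ`-morphism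
`p : M → Q` such that (i) `T_Γ̄ ≫ p = p` for every `γ ∈ K_δ(N₀)` with residue `Γ̄ ∈ GL_{2g}(ℤ/N)` keeping the universal
level structure symplectic-liftable (the hypothesis `hp` of ★ `existsUnique_desc_classifyingMap_left_comp` /
★ `exists_desc_classifyingMap`), and (ii) every `ℚ`-morphism `h : M → Z` to a separated `Z` with the same invariance
factors uniquely through `p`.  The slim form of `exists_levelGroupQuotient_action` (surjectivity from the geometric
quotient, `Q` locally Noetherian because locally of finite type over `ℚ`).
[cite: MumfordFogartyKirwan1994, Ch. 7 §3 (pp. 139–140) and Lemma 7.11 (p. 140)] [cite: MumfordAV1970, §7 Thm. p. 66] -/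
theorem exists_levelGroupQuotient (hδ : IsPolarizationType δ) (hg : 0 < g) (N₀ : ℕ)
    (hqp : IsQuasiProjectiveOver 𝓜.M) :
    ∃ (Q : SchemeOver ℚ) (p : 𝓜.M ⟶ Q), IsFinite p.left ∧ Surjective p.left ∧ IsSeparated Q.hom ∧
      LocallyOfFiniteType Q.hom ∧ IsLocallyNoetherian Q.left ∧
      (∀ (r : gspFinAdelic δ) (_ : r ∈ principalLevelSubgroup δ N₀) (GN : GL (Fin g ⊕ Fin g) (ZMod N))
        (_ : ∀ (i j : Fin g ⊕ Fin g)
          (h : ((r : GL (Fin g ⊕ Fin g) finAdeleQ) : Matrix (Fin g ⊕ Fin g) (Fin g ⊕ Fin g) finAdeleQ) i j ∈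
            FiniteAdeleRing.integralAdeles (𝓞 ℚ) ℚ),
          (GN : Matrix (Fin g ⊕ Fin g) (Fin g ⊕ Fin g) (ZMod N)) i j = integralAdeleResidue N ⟨_, h⟩)
        (hs : (𝓜.univ.level.twist GN).IsSymplecticLiftable 𝓜.univ.pol δ),
        (haveI := 𝓜.isLocallyNoetherian
         (𝓜.classifyingMap 𝓜.M ({ 𝓜.univ with level := 𝓜.univ.level.twist GN, symplectic := hs } :
           PolarizedAbelianSchemeWithLevel g N δ 𝓜.M.left)).left) ≫ p.left = p.left) ∧
      ∀ (Z : SchemeOver ℚ) [Z.left.IsSeparated] (h : 𝓜.M ⟶ Z),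
        (∀ (r : gspFinAdelic δ) (_ : r ∈ principalLevelSubgroup δ N₀) (GN : GL (Fin g ⊕ Fin g) (ZMod N))
          (_ : ∀ (i j : Fin g ⊕ Fin g)
            (h : ((r : GL (Fin g ⊕ Fin g) finAdeleQ) : Matrix (Fin g ⊕ Fin g) (Fin g ⊕ Fin g) finAdeleQ) i j ∈
              FiniteAdeleRing.integralAdeles (𝓞 ℚ) ℚ),
            (GN : Matrix (Fin g ⊕ Fin g) (Fin g ⊕ Fin g) (ZMod N)) i j = integralAdeleResidue N ⟨_, h⟩)
          (hs : (𝓜.univ.level.twist GN).IsSymplecticLiftable 𝓜.univ.pol δ),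
          (haveI := 𝓜.isLocallyNoetherian
           𝓜.classifyingMap 𝓜.M ({ 𝓜.univ with level := 𝓜.univ.level.twist GN, symplectic := hs } :
             PolarizedAbelianSchemeWithLevel g N δ 𝓜.M.left)) ≫ h = h) →
        ∃! hQ : Q ⟶ Z, p ≫ hQ = h := by
  obtain ⟨_, _, _, Q, p, _, -, -, -, -, -, hq, hfin, hsep, hlft, -, hp, huniv⟩ :=
    𝓜.exists_levelGroupQuotient_action hδ hg N₀ hqp
  haveI := hlft
  have hsurj : Surjective p.left := ⟨ActionOver.IsGeometricQuotient.surjective hq⟩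
  exact ⟨Q, p, hfin, hsurj, hsep, hlft, LocallyOfFiniteType.isLocallyNoetherian Q.hom, hp, huniv⟩

end SiegelFineModuliScheme

end Literature.AlgebraicGeometry.ModuliOfAbelianVarieties

end
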